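import Summits.Ventures.HodgeRepro2.T5SU11BorelSubgroup
import Summits.Ventures.HodgeRepro2.T5SU11IwasawaUnique

/-!
# The Borel subgroup acts simply transitively on the disc

`T5SU11Iwasawa` shows that `N A` acts transitively on `𝔻` and `T5SU11IwasawaUnique` that the orbit
`(n_s a_t) · 0` determines `(s, t)`. Hence `(s, t) ↦ (n_s a_t) · 0` is a BIJECTION `ℝ × ℝ → 𝔻`
(`orbit_unip_mul_hyp_bijOn`), and the Borel subgroup `B = A N` of `T5SU11BorelSubgroup` acts SIMPLY
TRANSITIVELY on the disc: for every `z ∈ 𝔻` there is exactly one `b ∈ B` with `b · 0 = z`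
(`existsUnique_orbit_eq`), and the stabiliser of `0` in `B` is trivial (`eq_one_of_mem_of_orbit_eq_zero`).
In particular `B ∩ K = 1` and `SU(1,1) = K · B = B · K` with unique factorisation. Nothing is claimed
about (N).

Blind lane: Mathlib + the HodgeRepro2 prefix only; no sorry; axioms ⊆ {propext, Classical.choice,
Quot.sound}.
-/

namespace Summit.Ventures.HodgeRepro2.T5SU11BorelTransitive

open Metric Filter Topology Set
open T5UnitaryBound T5PoincareDensity T5PoincareInvariance T5SU11Unimodular T5SU11Fibration
  T5SU11Cartan T5SU11OneParameter T5BergmanCoefficient T5SU11HyperbolicSubgroup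
  T5SU11UnipotentSubgroup T5SU11BorelSubgroup T5SU11Iwasawa T5SU11IwasawaUnique

/-! ### `(s, t) ↦ (n_s a_t) · 0` is a bijection onto the disc -/

/-- The orbit determines `(s, t)`: `(n_s a_t) · 0 = (n_{s'} a_{t'}) · 0` implies `s = s'`, `t = t'`. -/
theorem orbit_unip_mul_hyp_injective {s t s' t' : ℝ}
    (h : orbit (unip s * hyp t) = orbit (unip s' * hyp t')) : s = s' ∧ t = t' := by
  have htanh : Real.tanh t = Real.tanh t' := by
    rw [tanh_eq_of_orbit s t, h, ← tanh_eq_of_orbit s' t']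
  have ht : t = t' := tanh_injective htanh
  have hu : s * (1 - Real.tanh t) = s' * (1 - Real.tanh t') := by
    rw [mul_eq_of_orbit s t, h, ← mul_eq_of_orbit s' t']
  rw [← ht] at hu
  have h1τ : (1 - Real.tanh t) ≠ 0 := by
    have := Real.tanh_lt_one t
    linarith
  exact ⟨mul_right_cancel₀ h1τ hu, ht⟩

/-- **`(s, t) ↦ (n_s a_t) · 0` is a bijection `ℝ × ℝ → 𝔻`.** -/
theorem orbit_unip_mul_hyp_bijOn :
    Set.BijOn (fun p : ℝ × ℝ => orbit (unip p.1 * hyp p.2)) Set.univ (ball (0 : ℂ) 1) := by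
  refine ⟨fun p _ => orbit_mem_ball _, ?_, ?_⟩
  · rintro ⟨s, t⟩ - ⟨s', t'⟩ - h
    obtain ⟨hs, ht⟩ := orbit_unip_mul_hyp_injective h
    exact Prod.ext hs ht
  · intro z hz
    obtain ⟨s, t, h⟩ := exists_orbit_unip_mul_hyp_eq hz
    exact ⟨(s, t), Set.mem_univ _, h⟩

/-! ### The Borel subgroup acts simply transitively -/

/-- The orbit of `0` under `a_t n_s`: `(a_t n_s) · 0 = (n_{e^{2t} s} a_t) · 0`. -/
lemma orbit_hyp_mul_unip (t s : ℝ) :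
    orbit (hyp t * unip s) = orbit (unip (Real.exp (2 * t) * s) * hyp t) := by
  rw [hyp_mul_unip]

/-- **`B` acts transitively on the disc**: every `z ∈ 𝔻` is `b · 0` for some `b ∈ B`. -/
theorem exists_mem_orbit_eq {z : ℂ} (hz : z ∈ ball (0 : ℂ) 1) :
    ∃ b ∈ borelSubgroup, orbit b = z := by
  obtain ⟨s, t, h⟩ := exists_orbit_unip_mul_hyp_eq hz
  refine ⟨hyp t * unip (Real.exp (-(2 * t)) * s), hyp_mul_unip_mem_borelSubgroup _ _, ?_⟩
  rw [← unip_mul_hyp, h]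

/-- **The stabiliser of `0` in `B` is trivial**: `b ∈ B` with `b · 0 = 0` is `1`. -/
theorem eq_one_of_mem_of_orbit_eq_zero {b : SU11} (hb : b ∈ borelSubgroup) (h0 : orbit b = 0) :
    b = 1 := by
  obtain ⟨t, s, rfl⟩ := hb
  rw [orbit_hyp_mul_unip] at h0
  have h1 : orbit (unip (Real.exp (2 * t) * s) * hyp t) = orbit (unip 0 * hyp 0) := by
    rw [h0, unip_zero, hyp_zero, one_mul, orbit_one]
  obtain ⟨hs, ht⟩ := orbit_unip_mul_hyp_injective h1
  have hs0 : s = 0 := by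
    have := Real.exp_pos (2 * t)
    rcases mul_eq_zero.1 hs with h | h
    · exact absurd h this.ne'
    · exact h
  rw [ht, hs0, hyp_zero, unip_zero, one_mul]

/-- `B ∩ K = 1`: a rotation in `B` is the identity. -/
theorem rot_eq_one_of_mem {u : Circle} (h : rot u ∈ borelSubgroup) : rot u = 1 :=
  eq_one_of_mem_of_orbit_eq_zero h (orbit_rot u)

/-- **`B` acts simply transitively on the disc**: for every `z ∈ 𝔻` there is exactly one `b ∈ B` with
`b · 0 = z`. -/
theorem existsUnique_orbit_eq {z : ℂ} (hz : z ∈ ball (0 : ℂ) 1) :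
    ∃! b : borelSubgroup, orbit (b : SU11) = z := by
  obtain ⟨b, hb, hbz⟩ := exists_mem_orbit_eq hz
  refine ⟨⟨b, hb⟩, hbz, ?_⟩
  rintro ⟨b', hb'⟩ hb'z
  -- `b⁻¹ b' ∈ B` fixes `0`
  have hmem : b⁻¹ * b' ∈ borelSubgroup := borelSubgroup.mul_mem (borelSubgroup.inv_mem hb) hb'
  have h0 : orbit (b⁻¹ * b') = 0 := by
    have e : orbit (b⁻¹ * b') = orbit (b⁻¹ * b) := by
      rw [orbit_mul, orbit_mul, hb'z, hbz]
    rw [e, inv_mul_cancel, orbit_one]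
  have := eq_one_of_mem_of_orbit_eq_zero hmem h0
  have hb'b : b' = b := by
    have := congrArg (fun g => b * g) this
    simpa [mul_inv_cancel_left] using this
  exact Subtype.ext hb'b

/-- **Unique factorisation `SU(1,1) = K · B`**: every `g` is `rot u · b` with `b ∈ B`, uniquely. -/
theorem existsUnique_rot_mul_mem (g : SU11) :
    ∃! p : Circle × borelSubgroup, g = rot p.1 * (p.2 : SU11) := by
  obtain ⟨u, b, ⟨t, s, rfl⟩, h⟩ := exists_rot_mul_mem g
  refine ⟨(u, ⟨hyp t * unip s, hyp_mul_unip_mem_borelSubgroup t s⟩), h, ?_⟩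
  rintro ⟨u', ⟨b', hb'⟩⟩ h'
  simp only at h'
  -- `rot u' b' = rot u (a_t n_s)` ⇒ `rot (u⁻¹ u') = (a_t n_s) b'⁻¹ ∈ B ∩ K = 1`
  have e : rot u⁻¹ * rot u' = (hyp t * unip s) * b'⁻¹ := by
    rw [map_inv]
    calc (rot u)⁻¹ * rot u' = (rot u)⁻¹ * (rot u' * b') * b'⁻¹ := by group
      _ = (rot u)⁻¹ * (rot u * (hyp t * unip s)) * b'⁻¹ := by rw [← h', ← h]
      _ = (hyp t * unip s) * b'⁻¹ := by group
  have hmem : rot u⁻¹ * rot u' ∈ borelSubgroup := by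
    rw [e]
    exact borelSubgroup.mul_mem (hyp_mul_unip_mem_borelSubgroup t s) (borelSubgroup.inv_mem hb')
  rw [← map_mul] at hmem
  have h1 := rot_eq_one_of_mem hmem
  have hu : u⁻¹ * u' = 1 := rot_injective (by rw [h1, map_one])
  have hu' : u' = u := by
    have := congrArg (fun v => u * v) hu
    simpa using this
  have hb : b' = hyp t * unip s := by
    rw [hu'] at h'
    exact (mul_left_cancel (h.symm.trans h')).symm
  exact Prod.ext hu' (Subtype.ext hb)

end Summit.Ventures.HodgeRepro2.T5SU11BorelTransitive
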